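import Summits.BirchSwinnertonDyer.BirchSwinnertonDyer.Theorems.KatoDescentTamePotSupersingularTameUpperUnitTwistRecordRoads
import Summits.BirchSwinnertonDyer.BirchSwinnertonDyer.Theorems.Rank1ResidualX11RankOneReduction
import Literature.NumberTheory.EllipticCurves.IsogenyHasCMIffJMemProofs
import HarnessLib

/-!
# Route `KatoDescentPotSupersingular` (rung K9, sub-rung B5 = O6 wild `p = 3`, cell `bsd-potss`): the UNIT-TWIST ROAD on the ♯ rows
# whose single Tamagawa carrier is the wild prime itself (`q = p = 3`, Kodaira IV/IV*, `3 ∣ c₃(E)`) — road and record-input form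
# (seat `bsd-potss-k9-c4` g17; route-free; a CERTIFICATE SHAPE — nothing booked, no item closed, BSD is not proved by any of this)

WHY. The per-row kernel RECORDS of the U₀-ns rows of K9 items 19189 `WildUpperNonsurjTower` / 19197 `WildUpperDefectRankZero`
(k9-c4 g16: 236 rows) instantiate the ♭ unit-twist road (kmc F15: `p ∤ ∏ c_ℓ(E)`) or k8t-c4's ♯ road
`TameUpperUnitTwistRoad.missingUpperBoundAt_rankZero_of_optimalDatum_of_jetchev08TwoSplit_of_unitTwist` (p573646: ONE Tamagawa
carrier `q ∥ N`, `q ≠ p`, `p ∤ c_p`, the two-split Jetchev reading `hJ2` displayed). On the WILD rows a third kind occurs which the (t′) rows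
never show: `3 ∣ c₃(E)` (Kodaira type IV or IV* at the additive prime `3` itself — 77 of the 364 K9 U₀-ns rows; 58 of them carry
`ord₃ ∏ c_ℓ(E) = 1`, i.e. `3` is the ONLY carrier). p573646 excludes them twice (`hcp : ¬ p ∣ c_p`, `hsingle : … q ≠ p`). THIS FILE is
p573646 with the carrier moved to `q = p`: the displayed schema becomes `hJp` = the body of the K9 aside crux
`WildJetchevBoundAtPTwoSplit` (item 21422) VERBATIM — the `q = p` Jetchev–Kolyvagin bound
`ord_p #Ш(E/K)[p^∞] + 2·ord_p c_p(E) ≤ 2·ord_p [E(K) : ℤP]` at Heegner fields in which `2` splits — which is a KERNEL THEOREM modulo the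
same four held named facts as `hJ2` (Matar–Nekovář 2019 Thm 0.7, Gross 1991 Prop. 3.7 (2), Poitou–Tate for Selmer structures,
Gross–Zagier III (3.1) image-free) and the route's held `PublishedInputsHeegner`: k9-c4 g11
`JetchevIrreducibleSwapAtP.wildJetchevBoundAtPTwoSplit_of_namedFacts` (p564034; route-importing, hence DISPLAYED here, exactly as p573646
displays `hJ2` ⟸ p564108). The single-carrier clause becomes `hcarrier : ord_p ∏ c_ℓ(E) ≤ ord_p c_p(E)`; the guard `p ∤ c_p` and the
Matar–Nekovář 0.3 binder `hMN` disappear (`hJp` covers the `p ∤ ∏ c_ℓ` case too). Everything else — the Heegner datum and the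
`K`-rational Heegner point of the OPTIMAL datum, Manin–Drinfeld rationality at the datum, the trivial lower half at the unit twist,
Gross–Zagier non-torsion, Kolyvagin finiteness, and the squeeze
`TameUpperHeegnerSharpRoad.missingUpperBoundAt_tame_rankZero_of_heegnerData_of_lowerTwist_of_sharpIndexBound` (k8t-c4 g6,
reduction-type-free beyond `Addv`) — is p573646 verbatim.

* §0 `not_hasCM_of_intModel_of_forall_ne` — non-CM from the integer model by the thirteen CM `j`-invariants (tree THEOREM
  `hasCM_iff_j_mem_holds`), for the rows with NO multiplicative prime (42 of the 77: `N = 2^a·3^3·q^2`), where the records' usual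
  witness (multiplicative reduction at the carrier) is unavailable.
* §1 `missingUpperBoundAt_rankZero_of_optimalDatum_of_jetchev08AtPTwoSplit_of_unitTwist` — the ♯ₚ road (data level, `N = N(E)`).
* §2 `missingUpperBoundAt_sharpAtP_of_datum_of_unitTwist` — the same in RECORD-INPUT form (conductor displayed as `hN : N(E) = N`,
  datum of level `N`, `d_K ≡ 1 (mod 8)`, `d_K < −4`, unit certificate `(qd, hqd, hvd)`), the shape the records instantiate.

HONEST FRAMING: CONDITIONAL on every displayed hypothesis — the named published facts `hGZ hKo hGZK hmod`, the SCHEMA `hJp` (crux 21422's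
body; an OPEN K9 aside as an item, a kernel theorem only modulo the four held facts), and per row the displayed census data; the twist's
analytic rank and `#Ш_an` are NUMERICAL data displayed as hypotheses by the records; per-ROW statements (never a ∀-item); closes
nothing; items 19189 / 19197 / 21422 stay OPEN; 0 definitions, 0 named facts minted, 0 `sorry`.

References: [Jetchev2008] Conj. 1.3, Thm. 1.4, Cor. 1.5, Rem. 6.2; [MatarNekovar2019] Thm. 0.7, §0.11; [GrossLMS1991] Prop. 3.7 (2);
[GrossZagier1986] I.6.3, III (3.1), V.§2; [KolyvaginEulerSystems1990] Thm. A; [Manin1972] Cor. 3.6; [EdixhovenManin1991] §1;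
[SilvermanAEC2009] App. C §11; [Marcus2018] Ch. 3 Thm. 25; [Miller2011LMS] Def. 1.1.
-/

set_option autoImplicit false
-- the Theorems directory repeats the summit name (sibling precedent `KatoDescentPotSupersingularAssembly.lean`)
set_option linter.dupNamespace false

noncomputable section

open scoped Classical NumberField

namespace Summit.BirchSwinnertonDyer.BirchSwinnertonDyer.Theorems.WildUpperUnitTwistRoadAtP

open WeierstrassCurve IsDedekindDomain IsDedekindDomain.HeightOneSpectrum NumberField
  Rat.HeightOneSpectrum Literature.NumberTheory.EllipticCurves
  Literature.NumberTheory.EllipticCurves.ModularForms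
  Literature.NumberTheory.DiophantineGeometry
  Literature.NumberTheory.EllipticCurves.Rank1Residual
  Literature.NumberTheory.EllipticCurves.Rank1Residual.Typed
  Literature.NumberTheory.EllipticCurves.Rank1Residual.X11RankOneCertificates
  Literature.NumberTheory.Automorphic Literature.NumberTheory.EllipticCurves.KrizLi2019
  Literature.NumberTheory.QuadraticFields
  Summit.BirchSwinnertonDyer.Rank1Residual
  Summit.BirchSwinnertonDyer.Rank1Residual.Additive
  Summit.BirchSwinnertonDyer.BirchSwinnertonDyer.Rank1Residual.IntModel
  Summit.BirchSwinnertonDyer.BirchSwinnertonDyer.Rank1Residual.X11RankOne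
  Summit.BirchSwinnertonDyer.BirchSwinnertonDyer.Theorems
  Summit.BirchSwinnertonDyer.BirchSwinnertonDyer.Theorems.TameUpperHeegnerSharpRoad

/-! ### §0 Non-CM from the integer model (rows with no multiplicative prime) -/

/-- **NOT CM from the integer model by the thirteen CM `j`-invariants**: if `[a₁,…,a₆]` is the integral model of the globally minimal
`W` with `c₄ = C`, `Δ = D` (the recheck's `c4Of` / `discOf`, kernel-decidable) and `C³ ≠ j₀·D` for each of the thirteen rational CM
`j`-invariants `j₀`, then `W` has no CM — since `j(W) = C³/D` and `HasCM ↔ j ∈ cmJInvariants` is the tree THEOREM `hasCM_iff_j_mem_holds`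
(Silverman App. C §11). For record rows whose conductor has no prime to the first power. [cite: SilvermanAEC2009, App. C §11 Examples 11.3.1–11.3.2, III.1 (p. 42)] -/
theorem not_hasCM_of_intModel_of_forall_ne {W : WeierstrassCurve ℚ} [W.IsElliptic] [W.IsGloballyMinimal]
    (a1 a2 a3 a4 a6 : ℤ) (hW : integralModelInt W = ⟨a1, a2, a3, a4, a6⟩) {C D : ℤ}
    (hC : c4Of [a1, a2, a3, a4, a6] = C) (hD : discOf [a1, a2, a3, a4, a6] = D)
    (h : ∀ j₀ ∈ cmJInvariants, (C : ℚ) ^ 3 ≠ j₀ * (D : ℚ)) : ¬ W.HasCM := by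
  intro hCM
  have hj := (WeierstrassCurve.hasCM_iff_j_mem_holds W).mp hCM
  have hΔ : W.Δ = (D : ℚ) := by rw [Δ_eq_cast hW, intCurve_Δ, hD]
  have hc4 : W.c₄ = (C : ℚ) := by rw [c₄_eq_cast hW, intCurve_c₄, hC]
  have hD0 : (D : ℚ) ≠ 0 := by rw [← hΔ, ← coe_Δ']; exact W.Δ'.ne_zero
  have hjW : W.j = (C : ℚ) ^ 3 / (D : ℚ) := by
    rw [WeierstrassCurve.j, Units.val_inv_eq_inv_val, coe_Δ', hΔ, hc4, div_eq_inv_mul]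
  rw [hjW] at hj
  exact h _ hj (by rw [div_mul_cancel₀ _ hD0])

/-! ### §1 The ♯ₚ unit-twist road (carrier `q = p`) -/

/-- **♯ₚ UNIT-TWIST ROAD (per row, NO open-problem input beyond the displayed schema).** p573646
(`TameUpperUnitTwistRoad.missingUpperBoundAt_rankZero_of_optimalDatum_of_jetchev08TwoSplit_of_unitTwist`) with the single Tamagawa
carrier moved to the additive prime `p` itself: at a rank-`0` row (`Addv W p`, `ord_p j ≥ 0`, non-CM, `W[p]` irreducible with `p`-adic
tower NOT onto) carrying a lattice-OPTIMAL modular parametrisation datum `D` of level `N(E)` with `p ∤ c(D)` and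
`hcarrier : ord_p ∏ c_ℓ(E) ≤ ord_p c_p(E)` (every `p` in the Tamagawa product sits at `p`; vacuous demand when `p ∤ ∏ c_ℓ`), a GIVEN
Heegner field `K` (`|d_K| > 4`, every `ℓ ∣ N(E)` and `2` split) and a GIVEN globally minimal model `Wd` of `E^{(d_K)}` of analytic rank `1`
with the displayed NUMERICAL certificate `hunit : #Ш(E^{(d_K)})_an ∈ ℚ`, `ord_p ≤ 0`, the UPPER half `ord_p #Ш(E) ≤ ord_p #Ш(E)_an`
follows from: the SCHEMA `hJp` = the body of crux `WildJetchevBoundAtPTwoSplit` (item 21422) verbatim — `ord_p #Ш(E/K)[p^∞] + 2·ord_p c_p(E)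
≤ 2·ord_p [E(K):ℤP]` at a non-torsion Heegner point of an optimal datum, `2` split in `K` (a kernel theorem modulo Matar–Nekovář 0.7 +
Gross 3.7 (2) + Poitou–Tate + GZ86 III (3.1) + `PublishedInputsHeegner`: k9-c4 g11 p564034) —, Gross–Zagier (`hGZ`), Kolyvagin (`hKo`),
GZK (`hGZK`), modularity (`hmod`), and the row's displayed data. Proof = p573646 verbatim (Heegner datum / `K`-rational Heegner point of
`D` / Manin–Drinfeld rationality / trivial lower half at the unit twist / GZ non-torsion / Kolyvagin finiteness), the product-form index
bound `ord_p #Ш(E/K) + 2·ord_p ∏c_ℓ ≤ 2·ord_p [E(K):ℤP]` now from `hJp` at `N = N(E)` (`p ∣ N(E)` by `Addv`) and `hcarrier`, then the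
squeeze `missingUpperBoundAt_tame_rankZero_of_heegnerData_of_lowerTwist_of_sharpIndexBound` (reduction-type-free beyond `Addv`).
CONDITIONAL on the displayed schema and named facts; nothing booked; NO item closed; a per-row CERTIFICATE SHAPE for the `q = p`
rows of K9 items 19189 / 19197. [cite: Jetchev2008, Conj. 1.3, Cor. 1.5 (p. 812), Rem. 6.2] [cite: MatarNekovar2019, Thm. 0.7 (p. 456), §0.11 (p. 457)]
[cite: GrossZagier1986, Thm. I.6.3] [cite: KolyvaginEulerSystems1990, Thm. A] [cite: Manin1972, Cor. 3.6] [cite: EdixhovenManin1991, §1]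
[cite: Miller2011LMS, Def. 1.1] -/
theorem missingUpperBoundAt_rankZero_of_optimalDatum_of_jetchev08AtPTwoSplit_of_unitTwist
    (hGZ : ∀ (N : ℕ) [NeZero N] (W : WeierstrassCurve ℚ) (K : Type) [Field K] [NumberField K],
      gross_zagier N W K)
    (hKo : ∀ (N : ℕ) [NeZero N] (W : WeierstrassCurve ℚ) (K : Type) [Field K] [NumberField K],
      kolyvagin N W K)
    (hGZK : rank_eq_analyticRank_of_analyticRank_le_one) (hmod : hasEntireLFunction_rat)
    (hJp : ∀ (N : ℕ) [NeZero N] (W : WeierstrassCurve ℚ) [W.IsElliptic] [W.IsGloballyMinimal]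
      (K : Type) [Field K] [NumberField K],
      IsImaginaryQuadratic K → NumberField.discr K ≠ -3 →
      SatisfiesHeegnerHypothesis N K → SatisfiesHeegnerHypothesis 2 K →
      ∀ (p : ℕ) [Fact p.Prime], p ≠ 2 → W.analyticRank = 0 → Addv W p → 0 ≤ padicValRat p W.j →
      ¬ W.HasCM → W.HasIrreducibleModPGaloisRep p →
      ¬ (∀ n : ℕ, W.HasSurjectiveModNGaloisRep (p ^ n : ℕ)) →
      (∃ Dt : ModularParametrizationData W N,
        (∀ z ∈ Dt.L.lattice, ∃ w ∈ periodLattice Dt.f, z = (Dt.c : ℂ) * w) ∧ ¬ (p : ℤ) ∣ Dt.c) →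
      ∀ {P : (W.baseChange K).toAffine.Point}, IsHeegnerPoint N W K P → ¬ IsOfFinAddOrder P → p ∣ N →
      padicValNat p (Nat.card (AddCommGroup.primaryComponent (W.baseChange K).sha p)) +
          2 * padicValNat p ((W.baseChange ℚ_[p]).localTamagawaNumber ℤ_[p]) ≤
        2 * padicValNat p (AddSubgroup.zmultiples P).index)
    (W : WeierstrassCurve ℚ) [W.IsElliptic] [W.IsGloballyMinimal] (p : ℕ) [Fact p.Prime]
    [NeZero (W.conductorNorm ℤ)] (hr : W.analyticRank = 0) (hp2 : p ≠ 2) (hadd : Addv W p)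
    (hj : 0 ≤ padicValRat p W.j) (hcm : ¬ W.HasCM) (hirr : W.HasIrreducibleModPGaloisRep p)
    (hns : ¬ (∀ n : ℕ, W.HasSurjectiveModNGaloisRep (p ^ n : ℕ)))
    (D : ModularParametrizationData W (W.conductorNorm ℤ))
    (hopt : ∀ z ∈ D.L.lattice, ∃ w ∈ periodLattice D.f, z = (D.c : ℂ) * w) (hc : ¬ (p : ℤ) ∣ D.c)
    (hcarrier : padicValNat p W.tamagawaProduct ≤
      padicValNat p ((W.baseChange ℚ_[p]).localTamagawaNumber ℤ_[p]))
    (K : Type) [Field K] [NumberField K] (hK : IsImaginaryQuadratic K)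
    (hB : 4 < (NumberField.discr K).natAbs) (hHN : SatisfiesHeegnerHypothesis (W.conductorNorm ℤ) K)
    (h2K : SatisfiesHeegnerHypothesis 2 K)
    (Wd : WeierstrassCurve ℚ) [Wd.IsElliptic] [Wd.IsGloballyMinimal] (Cd : VariableChange ℚ)
    (hWd : Cd • W.quadraticTwist (NumberField.discr K : ℚ) = Wd) (hrd : Wd.analyticRank = 1)
    (hunit : ∃ qd : ℚ, shaAn Wd = (qd : ℂ) ∧ padicValRat p qd ≤ 0) :
    MissingUpperBoundAt W p := by
  have hp : p.Prime := Fact.out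
  -- `p ∣ N(E)`: the row is additive at `p`
  have hpN : p ∣ W.conductorNorm ℤ :=
    (W.dvd_conductorNorm_iff_not_hasGoodReductionAtPrime p).mpr (not_good_of_addv W p hadd)
  -- the GIVEN Heegner field: `2` splits (`h2K`), `|d_K| > 4` (`hB`)
  have hodd : Odd (NumberField.discr K) := by
    have h2 : ¬ ((2 : ℕ) : ℤ) ∣ NumberField.discr K :=
      Literature.SatisfiesHeegnerHypothesis.not_dvd_discr hK.1 h2K Nat.prime_two (dvd_refl 2)
    rw [← Int.not_even_iff_odd, even_iff_two_dvd]
    exact_mod_cast h2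
  haveI : IsTotallyComplex K := hK.2
  have hneg : NumberField.discr K < 0 := discr_neg_of_finrank_eq_two K hK.1
  have hdK : NumberField.discr K < -4 := by omega
  have hD3 : NumberField.discr K ≠ -3 := by omega
  -- the Heegner datum and the `K`-rational Heegner point of the OPTIMAL datum `D`
  obtain ⟨β, hβ⟩ := exists_dvd_sq_sub_discr_holds (W.conductorNorm ℤ) K hK hHN
  obtain ⟨H, -⟩ := nonempty_heegnerDatum_holds (W.conductorNorm ℤ) K hK hβ
  obtain ⟨ι⟩ : Nonempty (K →+* ℂ) := inferInstance
  obtain ⟨P, hP⟩ := heegnerPointComplex_mem_range_map_holds (W.conductorNorm ℤ) W K hK hHN D H ι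
  -- the GIVEN globally minimal model `Wd` of the twist, of analytic rank ONE (`hrd`)
  have hD0 : (NumberField.discr K : ℚ) ≠ 0 := by exact_mod_cast NumberField.discr_ne_zero K
  haveI hEt : (W.quadraticTwist (NumberField.discr K : ℚ)).IsElliptic :=
    W.isElliptic_quadraticTwist hD0
  have hrt : (W.quadraticTwist (NumberField.discr K : ℚ)).analyticRank = 1 := by
    rw [← analyticRank_smul _ Cd, hWd]
    exact hrd
  -- rationality of `L(E,1)/Ω(E)`: Manin–Drinfeld at the datum `D` (tree theorems; NO L₀ input)
  obtain ⟨q0, hq0⟩ : ∃ q0 : ℚ, W.entireLFunction 1 / (W.realPeriodRat : ℂ) = (q0 : ℂ) := by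
    obtain ⟨ϖ, -, hϖ, hΩ⟩ := D.exists_rat_mul_realPeriodRat_eq_plusPeriod
    refine ⟨ratPlusSymbol D.f 0 * ϖ, ?_⟩
    have hΩ0 : (W.realPeriodRat : ℂ) ≠ 0 := by exact_mod_cast hΩ.ne'
    rw [div_eq_iff hΩ0, D.isNewformOf.entireLFunction_one_eq, ← hϖ]
    push_cast
    ring
  -- the LOWER half at the twist is TRIVIAL: `#Ш(E^{(d_K)})_an` is a `p`-adic unit (`hunit`)
  have hlowd : MissingLowerBoundAt Wd p := by
    obtain ⟨qd, hqd, hv⟩ := hunit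
    exact ⟨qd, hqd, hv.trans (by exact_mod_cast Nat.zero_le _)⟩
  -- the Heegner point has infinite order (`L(E,1)·L'(E^{(d_K)},1) ≠ 0`, Gross–Zagier)
  have hLt' : (W.quadraticTwist (NumberField.discr K : ℚ)).entireLFunction = Wd.entireLFunction := by
    rw [← hWd, entireLFunction_smul]
  have hLt0 : (W.quadraticTwist (NumberField.discr K : ℚ)).entireLFunction 1 = 0 :=
    entireLFunction_one_eq_zero_of_analyticRank_eq_one hrt
  obtain ⟨-, hderivd⟩ := leadingLCoeff_eq_deriv_of_analyticRank_eq_one hrd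
  have hLW : W.entireLFunction 1 ≠ 0 := (W.analyticRank_eq_zero_iff_holds (hmod W)).1 hr
  have hLK : LDerivEK W K ≠ 0 := by
    rw [AdditivePotMult.lDerivEK_eq_mul_deriv W K hmod hLt0, hLt']
    exact mul_ne_zero hLW hderivd
  have hPH : IsHeegnerPoint (W.conductorNorm ℤ) W K P := ⟨D, H, ι, hP⟩
  have hnt : ¬ IsOfFinAddOrder P :=
    (lDerivEK_ne_zero_iff_not_isOfFinAddOrder W (W.conductorNorm ℤ) K (hGZ _ W K) hK hHN
      hPH).mp hLK
  -- Kolyvagin: `Ш(E/K)` is finite, so the `p`-primary count is the full count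
  obtain ⟨-, hfinK⟩ := (hKo _ W K) hK hHN hPH hnt
  haveI : Finite (W.baseChange K).sha := hfinK
  -- the index bound in PRODUCT form at this datum: `hJp` at the carrier `q = p`, single carrier by `hcarrier`
  have hJ : padicValNat p (Nat.card (W.baseChange K).sha) + 2 * padicValNat p W.tamagawaProduct ≤
      2 * padicValNat p (AddSubgroup.zmultiples P).index := by
    have hprim := hJp (W.conductorNorm ℤ) W K hK hD3 hHN h2K p hp2 hr hadd hj hcm hirr hns ⟨D, hopt, hc⟩
      hPH hnt hpN
    have heq : padicValNat p (Nat.card (AddCommGroup.primaryComponent (W.baseChange K).sha p)) =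
        padicValNat p (Nat.card (W.baseChange K).sha) :=
      padicValNat_card_addPrimaryComponent p
    rw [heq] at hprim
    omega
  exact missingUpperBoundAt_tame_rankZero_of_heegnerData_of_lowerTwist_of_sharpIndexBound hp2 hadd hr K D H
    ι P (hGZ _ W K) (hKo _ W K) hGZK hmod hK hHN hodd hdK hP hc Wd Cd hWd hrd q0 hq0 hlowd hJ

/-! ### §2 The ♯ₚ road in RECORD-INPUT form -/

/-- **♯ₚ UNIT-TWIST ROAD, record-input form.** §1 with its Heegner-field inputs repackaged for records, exactly as p597083 §2 repackages
p573646: the conductor is displayed as `hN : W.conductorNorm ℤ = N` (Cremona), the datum `D` is of level `N`, the Heegner hypothesis is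
given at level `N` (`hHN`; a record derives it from `d_K` by `satisfiesHeegnerHypothesis_iff_kronecker` and `norm_num`), and the
hypotheses `|d_K| > 4`, «`2` splits in `K`» are derived from `d_K ≡ 1 (mod 8)` (`h8`) and `d_K < −4` (`hd4`); the unit certificate is
given as `(qd, hqd, hvd)`. Row inputs as in §1: `r_an(W) = 0`, `Addv W p`, `ord_p j ≥ 0`, non-CM, `W[p]` irreducible with `p`-adic
tower NOT onto, the lattice-OPTIMAL datum `D` (`hopt`) with `p ∤ c(D)`, the single carrier at `p` (`hcarrier : ord_p ∏c_ℓ ≤ ord_p c_p`),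
and the schema `hJp` (crux 21422's body verbatim ⟸ Matar–Nekovář 0.7 + Gross 3.7 (2) + Poitou–Tate + GZ86 III (3.1) +
`PublishedInputsHeegner`, k9-c4 g11 p564034). CONDITIONAL on the displayed hypotheses; per row; closes nothing.
[cite: Jetchev2008, Conj. 1.3, Cor. 1.5 (p. 812)] [cite: MatarNekovar2019, Thm. 0.7 (p. 456)] [cite: GrossZagier1986, Thm. I.6.3]
[cite: Manin1972, Cor. 3.6] [cite: Marcus2018, Ch. 3 Thm. 25] [cite: Miller2011LMS, Def. 1.1] -/
theorem missingUpperBoundAt_sharpAtP_of_datum_of_unitTwist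
    (hGZ : ∀ (N : ℕ) [NeZero N] (W : WeierstrassCurve ℚ) (K : Type) [Field K] [NumberField K],
      gross_zagier N W K)
    (hKo : ∀ (N : ℕ) [NeZero N] (W : WeierstrassCurve ℚ) (K : Type) [Field K] [NumberField K],
      kolyvagin N W K)
    (hGZK : rank_eq_analyticRank_of_analyticRank_le_one) (hmod : hasEntireLFunction_rat)
    (hJp : ∀ (N : ℕ) [NeZero N] (W : WeierstrassCurve ℚ) [W.IsElliptic] [W.IsGloballyMinimal]
      (K : Type) [Field K] [NumberField K],
      IsImaginaryQuadratic K → NumberField.discr K ≠ -3 →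
      SatisfiesHeegnerHypothesis N K → SatisfiesHeegnerHypothesis 2 K →
      ∀ (p : ℕ) [Fact p.Prime], p ≠ 2 → W.analyticRank = 0 → Addv W p → 0 ≤ padicValRat p W.j →
      ¬ W.HasCM → W.HasIrreducibleModPGaloisRep p →
      ¬ (∀ n : ℕ, W.HasSurjectiveModNGaloisRep (p ^ n : ℕ)) →
      (∃ Dt : ModularParametrizationData W N,
        (∀ z ∈ Dt.L.lattice, ∃ w ∈ periodLattice Dt.f, z = (Dt.c : ℂ) * w) ∧ ¬ (p : ℤ) ∣ Dt.c) →
      ∀ {P : (W.baseChange K).toAffine.Point}, IsHeegnerPoint N W K P → ¬ IsOfFinAddOrder P → p ∣ N →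
      padicValNat p (Nat.card (AddCommGroup.primaryComponent (W.baseChange K).sha p)) +
          2 * padicValNat p ((W.baseChange ℚ_[p]).localTamagawaNumber ℤ_[p]) ≤
        2 * padicValNat p (AddSubgroup.zmultiples P).index)
    (W : WeierstrassCurve ℚ) [W.IsElliptic] [W.IsGloballyMinimal] (p : ℕ) [Fact p.Prime] (hp2 : p ≠ 2)
    {N : ℕ} [NeZero N] (hN : W.conductorNorm ℤ = N)
    (hr : W.analyticRank = 0) (hadd : Addv W p) (hj : 0 ≤ padicValRat p W.j) (hcm : ¬ W.HasCM)
    (hirr : W.HasIrreducibleModPGaloisRep p) (hns : ¬ (∀ n : ℕ, W.HasSurjectiveModNGaloisRep (p ^ n : ℕ)))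
    (D : ModularParametrizationData W N)
    (hopt : ∀ z ∈ D.L.lattice, ∃ w ∈ periodLattice D.f, z = (D.c : ℂ) * w) (hc : ¬ (p : ℤ) ∣ D.c)
    (hcarrier : padicValNat p W.tamagawaProduct ≤
      padicValNat p ((W.baseChange ℚ_[p]).localTamagawaNumber ℤ_[p]))
    (K : Type) [Field K] [NumberField K] (hK : IsImaginaryQuadratic K) (hHN : SatisfiesHeegnerHypothesis N K)
    (h8 : NumberField.discr K % 8 = 1) (hd4 : NumberField.discr K < -4)
    (Wd : WeierstrassCurve ℚ) [Wd.IsElliptic] [Wd.IsGloballyMinimal] (Cd : VariableChange ℚ)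
    (hWd : Cd • W.quadraticTwist (NumberField.discr K : ℚ) = Wd) (hrd : Wd.analyticRank = 1)
    {qd : ℚ} (hqd : shaAn Wd = (qd : ℂ)) (hvd : padicValRat p qd ≤ 0) :
    MissingUpperBoundAt W p := by
  subst hN
  have hB : 4 < (NumberField.discr K).natAbs := by omega
  have h2K : SatisfiesHeegnerHypothesis 2 K :=
    TameUpperUnitTwistRecords.satisfiesHeegnerHypothesis_two_of_discr_emod_eight K hK.1 h8
  exact missingUpperBoundAt_rankZero_of_optimalDatum_of_jetchev08AtPTwoSplit_of_unitTwist hGZ hKo hGZK hmod hJp W p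
    hr hp2 hadd hj hcm hirr hns D hopt hc hcarrier K hK hB hHN h2K Wd Cd hWd hrd ⟨qd, hqd, hvd⟩

end Summit.BirchSwinnertonDyer.BirchSwinnertonDyer.Theorems.WildUpperUnitTwistRoadAtP

end
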